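import Mathlib
import Summits.QuantumFields.YangMills.Theses.CoarseStiffnessTail
import Summits.QuantumFields.YangMills.Theorems.CoarseStiffnessTailHistoryTailOfStiffness

/-!
# Route `CoarseStiffnessTail` — HOW MUCH SLACK THE LINE HAS: a LOGARITHMIC, PER-COUPLING capped stiffness already gives
# `UnitScaleTilt.HistoryTailL` (crux 19936) through this route's glue (lead's certificate, seat `ym-line-cst-p1` g4; helper on 25301)

THE POINT.  The crux `CappedCoarseStiffnessL` (stmt-QuantumFields-25301) asks for free energy `O(1)` per level-`j` plaquette with constants
`(c₀, C₀)` chosen BEFORE the family `F` and the coupling `γ`: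
`∫ exp(c₀·β_{K−j}·X_j) dGibbs_K ≤ exp(C₀·#Plaq_j)`, `X_j = Σ_a min(|Ū^{j}(∂a) − 1|², θ(K−j)²)`, `β_{K−j} = (γL^{−(K−j)})⁻¹`.
The route's glue (item 25302, landed p608186) feeds the per-plaquette tail it extracts into the tree's bookkeeping
`T3AveragedTailProfile.historyTailAt_of_perPlaquette`, whose schema is `Gibbs_K{θ(K−j) ≤ |Ū^{j}(∂p) − 1|} ≤ C·β_{K−j}^A·e^{−c·p(g_{K−j})²}` with
`(C, A, c)` chosen AFTER `(F, γ)` and an arbitrary POLYNOMIAL prefactor `β^A` (the Gaussian-in-`p(g)` factor beats any power, `p₀ > 2`).  Hence the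
same chessboard + exponential-Chebyshev argument closes `HistoryTailL` from the WEAKER hypothesis

  LogStiffness := `∀ L b₀ p₀ (0 < b₀, 2 < p₀) ∃ γ₁ ∈ (0,1] ∀ F γ (F.L = L, 0 < γ ≤ γ₁) ∃ c₀ > 0, C₀, A : ℕ ∀ K j (j ≤ K):`
  `∫ exp(c₀·β_{K−j}·X_j) dGibbs_K ≤ exp((C₀ + A·log β_{K−j})·#Plaq_j)`

— free energy `O(1) + O(log β_{K−j})` per level-`j` plaquette, constants per `(F, γ)` (§2 `historyTailL_of_logStiffness`, via §1
`perPlaquette_of_logStiffness`: tail `≤ e^{9000L³|C₀|}·β_{K−j}^{9000L³A}·e^{−c₀p(g_{K−j})²}`); and trivially `CappedCoarseStiffnessL ⇒ LogStiffness`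
(§2 `logStiffness_of_cappedCoarseStiffnessL`, `A = 0`).  So the chain of sufficient conditions for 19936 through this line reads, kernel-checked:

  `CappedCoarseStiffnessL (25301) ⇒ LogStiffness ⇒ UnitScaleTilt.HistoryTailL (19936)`.

WHY IT MATTERS (for planners; nothing below is a new claim about Bałaban's estimates).
(1) The clause of the crux's why-fail «the level-j small-field Gaussian normalisation must cancel in the RATIO exactly» is a feature of the TYPED
    crux, not of what the line needs: an `A·log β_{K−j}` loss per plaquette — the size of the whole Gaussian volume `(3/2)·log β` per degree of
    freedom — is harmless downstream.  In particular the line card's «bare `j = 0` rung», NOT elementary uniformly in `γ` in the `O(1)` currency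
    (g2 memo: torus zero modes cost `(3/2)·r·log β_K`), HOLDS in the logarithmic currency by a two-line argument (companion file
    `CoarseStiffnessTailCappedCoarseStiffnessLBareLogStiffness`: tilted weight `≤ 1` for `4c₀ ≤ 1`, Haar small-ball floor of `Z`; constant `(3/2)·log β_K`
    per plaquette, absolute `C`).
(2) What LogStiffness still demands at `j ≥ 1` is joint sub-Gaussian control of the averaged plaquette deviations ABOVE `g_{K−j}·√(A'·log β_{K−j})`
    (the bonus `e^{c₀s²}` of smaller deviations is absorbed by `β^{A}`) up to the window edge `g·p(g)` — a MODERATE-deviation statement; the bulk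
    fluctuations of size `g_{K−j}` and the exact normalisation are no longer load-bearing.  By `CoarseStiffnessTailUnitSlice.integral_capTilt_eq_refine`
    the per-`(F, γ)` uniformity in `(K, j)` is uniformity over the refinement tower `(F.refine h, γL^{-h})`, i.e. still a `γ'' → 0` statement along
    the tower (the unit-law reading of that file applies verbatim with the logarithmic allowance).
(3) A planner may therefore RE-TYPE the crux as LogStiffness (strictly weaker, same payoff for rung R3) — a route decision (D-0019), not taken here.

HONEST SCOPE.  Pure measure theory + the landed chessboard (`HistoryTailChessboardT3.chessboardRP_T3`) and bookkeeping; §1 is the `A`-general twin of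
`CoarseStiffnessTailHistoryTailOfStiffness.perPlaquette_of_cappedStiffness` (g0), whose helper lemmas it reuses by name.  NOTHING of Bałaban's estimates
is proved: LogStiffness (at `j ≥ 1`), the crux 25301 and `HistoryTailL` 19936 stay OPEN; no rung, leaf or summit is proved — `YM3TorusSU2` (R3, a RECORD
rung, not the Clay statement) is NOT proved; the Yang–Mills mass gap is NOT touched.

References: J. Fröhlich, R. Israel, E. Lieb, B. Simon, CMP **62** (1978) 1–34 [FrohlichIsraelLiebSimon1978] (Thm 4.1, chessboard); T. Bałaban, CMP
**102** (1985) 255–275 [Balaban1985UV3] ((3) p.256, (7) p.257: couplings and thresholds; (71) p.273: the large-field factor these tails formalise).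
-/

noncomputable section

namespace Summit.QuantumFields.YangMills.Theorems.CoarseStiffnessTailLogStiffness

open MeasureTheory ProbabilityTheory Finset
open Literature.MathematicalPhysics.QuantumFieldTheory
open Literature.MathematicalPhysics.QuantumFieldTheory.Balaban1983to89
open Literature.MathematicalPhysics.QuantumFieldTheory.Balaban1983to89.T3ContinuumYM3Torus
open Literature.MathematicalPhysics.QuantumFieldTheory.Balaban1983to89.T3UnitScaleTilt
open Literature.MathematicalPhysics.QuantumFieldTheory.Balaban1983to89.T3UnitLawDensityEML
open Literature.MathematicalPhysics.QuantumFieldTheory.Balaban1983to89.T3AveragedTailProfile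
open Literature.MathematicalPhysics.QuantumFieldTheory.Balaban1983to89.T3FinestHeightTail (beta_mul_θBal_sq)
open Literature.MathematicalPhysics.QuantumFieldTheory.Balaban1983to89.T3MinimiserStabilityReduction (θBal_pos)
open Summit.QuantumFields.YangMills.Theorems.HistoryTailChessboardT3 (chessboardRP_T3)
open Summit.QuantumFields.YangMills.Theorems.CoarseStiffnessTailHistoryTailOfStiffness
  (card_plaq_le_of_chessboard measurable_capSum capSum_mem card_mul_sq_le_capSum)

/-! ## §1 The per-plaquette schema from a LOGARITHMIC capped stiffness bound (one family, one coupling) -/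

section PerPlaquette

variable (F : T3Family)

/-- **THE PER-PLAQUETTE SCHEMA FROM A LOGARITHMIC CAPPED STIFFNESS** (one family `F`, one coupling `0 < γ ≤ 1`, `0 < b₀`): if for some `c₀ > 0`,
`C₀` and `A : ℕ` the capped tilted partition functions obey `∫ exp(c₀β_{K−j}X_j) dGibbs_K ≤ exp((C₀ + A·log β_{K−j})·#Plaq_j)` for all `j ≤ K` —
free energy `O(1) + O(log β_{K−j})` per level-`j` plaquette — then every level-`j` averaged plaquette has the Gibbs tail
`Gibbs_K{θ(K−j) ≤ |Ū^j(∂p) − 1|} ≤ e^{9000L³|C₀|}·β_{K−j}^{9000L³A}·exp(−c₀·p(g_{K−j})²)`: chessboard (`chessboardRP_T3`, `ρ = 1`) + exponential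
Chebyshev on the joint event + `βθ² = p(g)²`, exactly as `CoarseStiffnessTailHistoryTailOfStiffness.perPlaquette_of_cappedStiffness` (the case
`A = 0`), the logarithm surfacing as a POLYNOMIAL prefactor in `β` — which the tree's bookkeeping `T3AveragedTailProfile.historyTailAt_of_perPlaquette`
tolerates. [cite: FrohlichIsraelLiebSimon1978, Thm 4.1] -/
theorem perPlaquette_of_logStiffness {γ b₀ p₀ c₀ C₀ : ℝ} {A : ℕ} (hγ : 0 < γ) (hγ1 : γ ≤ 1) (hb₀ : 0 < b₀) (hc₀ : 0 < c₀)
    (hX : ∀ (K j : ℕ), j ≤ K →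
      ∫ U, Real.exp (c₀ * (γ * ((F.L : ℝ)⁻¹) ^ (K - j))⁻¹ *
          ∑ a : Plaq (F.P K) j, min (GaugeGroup.dist1 (GaugeField.plaqHol
            (Averaging.iter (fun i => BlockAveraging.blockAvg (P := F.P K) (j := i) ℰp) j U) a) ^ 2)
            (θBal F.L γ b₀ p₀ (K - j) ^ 2)) ∂(gibbsK F ℰp γ K) ≤
        Real.exp ((C₀ + A * Real.log ((γ * ((F.L : ℝ)⁻¹) ^ (K - j))⁻¹)) * (Fintype.card (Plaq (F.P K) j) : ℝ))) :
    ∀ (K j : ℕ), 1 ≤ j → j ≤ K → ∀ p : Plaq (F.P K) j,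
      (gibbsK F ℰp γ K).real
          {U | θBal F.L γ b₀ p₀ (K - j) ≤
            GaugeGroup.dist1 (GaugeField.plaqHol
              (Averaging.iter (fun i => BlockAveraging.blockAvg (P := F.P K) (j := i) ℰp) j U) p)} ≤
        Real.exp (9000 * (F.L : ℝ) ^ 3 * |C₀|) * (F.scheme ℰp γ).β (K - j) ^ (9000 * F.L ^ 3 * A) *
          Real.exp (-(c₀ * B10.pFun b₀ p₀ (Real.sqrt (γ * ((F.L : ℝ)⁻¹) ^ (K - j))) ^ 2)) := by
  intro K j _hj1 hjK p
  haveI := isProbabilityMeasure_gibbsK F ℰp hγ.le K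
  have hL1 : 1 < F.L := F.hL.2
  have hL : 1 ≤ F.L := hL1.le
  set θ : ℝ := θBal F.L γ b₀ p₀ (K - j) with hθdef
  have hθ0 : 0 < θ := θBal_pos hL hγ hγ1 hb₀ p₀ (K - j)
  set β : ℝ := (γ * ((F.L : ℝ)⁻¹) ^ (K - j))⁻¹ with hβdef
  have hβ1 : 1 ≤ β := by
    have hL1' : (1 : ℝ) ≤ F.L := by exact_mod_cast F.hL.2.le
    have hL0' : (0 : ℝ) < F.L := lt_of_lt_of_le one_pos hL1'
    have hpos' : 0 < γ * ((F.L : ℝ)⁻¹) ^ (K - j) := mul_pos hγ (pow_pos (inv_pos.mpr hL0') _)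
    have hle' : γ * ((F.L : ℝ)⁻¹) ^ (K - j) ≤ 1 :=
      (mul_le_of_le_one_right hγ.le (pow_le_one₀ (inv_nonneg.mpr hL0'.le) (inv_le_one_of_one_le₀ hL1'))).trans hγ1
    exact (one_le_inv₀ hpos').mpr hle'
  have hβ0 : 0 < β := lt_of_lt_of_le one_pos hβ1
  have hlogβ : 0 ≤ Real.log β := Real.log_nonneg hβ1
  have hβeq : (F.scheme ℰp γ).β (K - j) = β := rfl
  -- the logarithmic constant at this height, and its nonnegative majorant
  set C₁ : ℝ := C₀ + A * Real.log β with hC₁def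
  set M : ℝ := |C₀| + A * Real.log β with hMdef
  have hM0 : 0 ≤ M := add_nonneg (abs_nonneg _) (mul_nonneg (Nat.cast_nonneg _) hlogβ)
  have hC₁M : C₁ ≤ M := by
    rw [hC₁def, hMdef]
    linarith [le_abs_self C₀]
  -- the capped stiffness observable
  set X : GaugeField (F.P K) 0 (Matrix.specialUnitaryGroup (Fin 2) ℂ) → ℝ := fun U =>
    ∑ a : Plaq (F.P K) j, min (GaugeGroup.dist1 (GaugeField.plaqHol
      (Averaging.iter (fun i => BlockAveraging.blockAvg (P := F.P K) (j := i) ℰp) j U) a) ^ 2) (θ ^ 2) with hXdef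
  -- the chessboard family at separation `ρ = 1`
  obtain ⟨S, hpS, -, hcount, hchess⟩ :=
    chessboardRP_T3 F.L F.hL.1 hL1 F γ rfl hγ hγ1 θ K j hjK 1 le_rfl p
  have hS0 : 0 < S.card := Finset.card_pos.mpr ⟨p, hpS⟩
  have hS0R : (0 : ℝ) < (S.card : ℝ) := by exact_mod_cast hS0
  -- the joint event lies in `{|S|θ² ≤ X}`
  have hsub : {U : GaugeField (F.P K) 0 (Matrix.specialUnitaryGroup (Fin 2) ℂ) |
        ∀ q ∈ S, θ ≤ GaugeGroup.dist1 (GaugeField.plaqHol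
          (Averaging.iter (fun _ => BlockAveraging.blockAvg ℰp) j U) q)} ⊆
      {U | (S.card : ℝ) * θ ^ 2 ≤ X U} := fun U hU =>
    card_mul_sq_le_capSum F K j hθ0.le S U hU
  -- integrability of `exp(t X)`, `t = c₀ β`
  set t : ℝ := c₀ * β with htdef
  have ht0 : 0 ≤ t := (mul_pos hc₀ hβ0).le
  have hint : Integrable (fun U => Real.exp (t * X U)) (gibbsK F ℰp γ K) := by
    have hmeas : Measurable fun U => Real.exp (t * X U) :=
      Real.measurable_exp.comp ((measurable_capSum F K j θ).const_mul t)
    refine (integrable_const (Real.exp (t * ((Fintype.card (Plaq (F.P K) j) : ℝ) * θ ^ 2)))).mono'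
      hmeas.aestronglyMeasurable (ae_of_all _ fun U => ?_)
    rw [Real.norm_eq_abs, abs_of_pos (Real.exp_pos _)]
    exact Real.exp_le_exp.mpr (mul_le_mul_of_nonneg_left (capSum_mem F K j θ U).2 ht0)
  -- exponential Chebyshev on the joint event
  have hmgf : mgf X (gibbsK F ℰp γ K) t ≤ Real.exp (C₁ * (Fintype.card (Plaq (F.P K) j) : ℝ)) := by
    have h := hX K j hjK
    simp only [mgf]
    convert h using 4
  have hjoint : (gibbsK F ℰp γ K).real {U | ∀ q ∈ S, θ ≤ GaugeGroup.dist1 (GaugeField.plaqHol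
        (Averaging.iter (fun _ => BlockAveraging.blockAvg ℰp) j U) q)} ≤
      Real.exp (-t * ((S.card : ℝ) * θ ^ 2)) * Real.exp (C₁ * (Fintype.card (Plaq (F.P K) j) : ℝ)) := by
    refine (measureReal_mono hsub).trans ?_
    refine (measure_ge_le_exp_mul_mgf ((S.card : ℝ) * θ ^ 2) ht0 hint).trans ?_
    exact mul_le_mul_of_nonneg_left hmgf (Real.exp_pos _).le
  -- take the `1/|S|`-th power
  have hbase0 : 0 ≤ (gibbsK F ℰp γ K).real {U | ∀ q ∈ S, θ ≤ GaugeGroup.dist1 (GaugeField.plaqHol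
        (Averaging.iter (fun _ => BlockAveraging.blockAvg ℰp) j U) q)} := measureReal_nonneg
  have hexpS : 0 ≤ (1 : ℝ) / (S.card : ℝ) := by positivity
  have hpow := Real.rpow_le_rpow hbase0 hjoint hexpS
  have hrhs : (Real.exp (-t * ((S.card : ℝ) * θ ^ 2)) * Real.exp (C₁ * (Fintype.card (Plaq (F.P K) j) : ℝ))) ^
        ((1 : ℝ) / (S.card : ℝ)) =
      Real.exp (-(t * θ ^ 2) + C₁ * (Fintype.card (Plaq (F.P K) j) : ℝ) / (S.card : ℝ)) := by
    rw [← Real.exp_add, ← Real.exp_mul]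
    congr 1
    field_simp
  rw [hrhs] at hpow
  refine (hchess.trans hpow).trans ?_
  -- the constants: `C₁ #Plaq_j / |S| ≤ 9000 L³ M` and `t θ² = c₀ p(g)²`
  have hcard : (Fintype.card (Plaq (F.P K) j) : ℝ) ≤ 9000 * (F.L : ℝ) ^ 3 * (S.card : ℝ) :=
    card_plaq_le_of_chessboard F K j hcount
  have hC : C₁ * (Fintype.card (Plaq (F.P K) j) : ℝ) / (S.card : ℝ) ≤ 9000 * (F.L : ℝ) ^ 3 * M := by
    rw [div_le_iff₀ hS0R]
    have h1 : C₁ * (Fintype.card (Plaq (F.P K) j) : ℝ) ≤ M * (Fintype.card (Plaq (F.P K) j) : ℝ) :=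
      mul_le_mul_of_nonneg_right hC₁M (Nat.cast_nonneg _)
    have h2 : M * (Fintype.card (Plaq (F.P K) j) : ℝ) ≤ M * (9000 * (F.L : ℝ) ^ 3 * (S.card : ℝ)) :=
      mul_le_mul_of_nonneg_left hcard hM0
    nlinarith
  have htθ : t * θ ^ 2 = c₀ * B10.pFun b₀ p₀ (Real.sqrt (γ * ((F.L : ℝ)⁻¹) ^ (K - j))) ^ 2 := by
    rw [htdef, mul_assoc, ← hβeq, hθdef, beta_mul_θBal_sq F hγ b₀ p₀ (K - j)]
  -- `exp(9000L³·M) = exp(9000L³|C₀|)·β^{9000L³A}`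
  have hsplit : Real.exp (9000 * (F.L : ℝ) ^ 3 * M) =
      Real.exp (9000 * (F.L : ℝ) ^ 3 * |C₀|) * β ^ (9000 * F.L ^ 3 * A) := by
    rw [hMdef, mul_add, Real.exp_add]
    congr 1
    rw [show 9000 * (F.L : ℝ) ^ 3 * (A * Real.log β) = ((9000 * F.L ^ 3 * A : ℕ) : ℝ) * Real.log β by push_cast; ring,
      ← Real.log_pow, Real.exp_log (pow_pos hβ0 _)]
  rw [hβeq, ← hsplit, mul_comm (Real.exp (9000 * (F.L : ℝ) ^ 3 * M)), ← Real.exp_add, htθ]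
  exact Real.exp_le_exp.mpr (by linarith)

end PerPlaquette

/-! ## §2 The LOGARITHMIC, PER-COUPLING capped stiffness: weaker than the crux, still sufficient for `HistoryTailL` -/

section Glue

/-- **crux ⇒ logarithmic per-coupling stiffness** (`A = 0`, constants uniform — the crux is the special case). [cite: Balaban1985UV3, (5) p.256] -/
theorem logStiffness_of_cappedCoarseStiffnessL
    (h : Summit.QuantumFields.YangMills.Theses.CoarseStiffnessTail.CappedCoarseStiffnessL) :
    ∀ (L : ℕ) (b₀ p₀ : ℝ), 0 < b₀ → 2 < p₀ → ∃ γ₁ : ℝ, 0 < γ₁ ∧ γ₁ ≤ 1 ∧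
      ∀ (F : T3Family) (γ : ℝ), F.L = L → 0 < γ → γ ≤ γ₁ → ∃ (c₀ C₀ : ℝ) (A : ℕ), 0 < c₀ ∧
        ∀ (K j : ℕ), j ≤ K →
          ∫ U, Real.exp (c₀ * (γ * ((F.L : ℝ)⁻¹) ^ (K - j))⁻¹ *
              ∑ a : Plaq (F.P K) j, min (GaugeGroup.dist1 (GaugeField.plaqHol
                (Averaging.iter (fun i => BlockAveraging.blockAvg (P := F.P K) (j := i) T3UnitLawDensityEML.ℰp) j U) a) ^ 2)
                (T3UnitScaleTilt.θBal F.L γ b₀ p₀ (K - j) ^ 2)) ∂(T3UnitScaleTilt.gibbsK F T3UnitLawDensityEML.ℰp γ K) ≤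
            Real.exp ((C₀ + A * Real.log ((γ * ((F.L : ℝ)⁻¹) ^ (K - j))⁻¹)) * (Fintype.card (Plaq (F.P K) j) : ℝ)) := by
  intro L b₀ p₀ hb₀ hp₀
  obtain ⟨c₀, C₀, γ₁, hc₀, hγ₁, hγ₁1, hb⟩ := h L b₀ p₀ hb₀ hp₀
  refine ⟨γ₁, hγ₁, hγ₁1, fun F γ hFL hγ hγγ₁ => ⟨c₀, C₀, 0, hc₀, fun K j hjK => ?_⟩⟩
  have key := hb F γ hFL hγ hγγ₁ K j hjK
  simpa only [Nat.cast_zero, zero_mul, add_zero] using key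

/-- **LOGARITHMIC PER-COUPLING CAPPED STIFFNESS ⇒ `UnitScaleTilt.HistoryTailL`** (crux stmt-QuantumFields-19936 of the parent route, by name):
the glue of this route (`CoarseStiffnessTailHistoryTailOfStiffness.historyTailOfStiffness_proof`, item 25302) goes through VERBATIM when the crux
`CappedCoarseStiffnessL` is weakened in two ways — (a) the free energy per level-`j` plaquette may grow like `C₀ + A·log β_{K−j}` instead of being
`O(1)`, and (b) the constants `(c₀, C₀, A)` may depend on the family `F` (volume exponent `m`) and on the coupling `γ` (only `γ₁` is chosen
before them) — because the tree's bookkeeping `T3AveragedTailProfile.historyTailAt_of_perPlaquette` accepts per-`(F, γ)` constants and a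
polynomial prefactor `β_{K−j}^{A'}` (`A' = 9000L³A`) in front of the Gaussian-in-`p(g)` tail.  Profile `b₀ = max b₁ 1`, `p₀ = max p₁ 3` as in the
landed glue.  Conditional certificate: the hypothesis is OPEN (weaker than the open crux 25301, which implies it by
`logStiffness_of_cappedCoarseStiffnessL`); no rung or summit is proved. [cite: Balaban1985UV3, (7) p.257 and (71) p.273] -/
theorem historyTailL_of_logStiffness
    (hW : ∀ (L : ℕ) (b₀ p₀ : ℝ), 0 < b₀ → 2 < p₀ → ∃ γ₁ : ℝ, 0 < γ₁ ∧ γ₁ ≤ 1 ∧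
      ∀ (F : T3Family) (γ : ℝ), F.L = L → 0 < γ → γ ≤ γ₁ → ∃ (c₀ C₀ : ℝ) (A : ℕ), 0 < c₀ ∧
        ∀ (K j : ℕ), j ≤ K →
          ∫ U, Real.exp (c₀ * (γ * ((F.L : ℝ)⁻¹) ^ (K - j))⁻¹ *
              ∑ a : Plaq (F.P K) j, min (GaugeGroup.dist1 (GaugeField.plaqHol
                (Averaging.iter (fun i => BlockAveraging.blockAvg (P := F.P K) (j := i) T3UnitLawDensityEML.ℰp) j U) a) ^ 2)
                (T3UnitScaleTilt.θBal F.L γ b₀ p₀ (K - j) ^ 2)) ∂(T3UnitScaleTilt.gibbsK F T3UnitLawDensityEML.ℰp γ K) ≤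
            Real.exp ((C₀ + A * Real.log ((γ * ((F.L : ℝ)⁻¹) ^ (K - j))⁻¹)) * (Fintype.card (Plaq (F.P K) j) : ℝ))) :
    Summit.QuantumFields.YangMills.Theses.UnitScaleTilt.HistoryTailL := by
  intro L b₁ p₁
  refine ⟨max b₁ 1, max p₁ 3, le_max_left _ _, le_max_left _ _, lt_of_lt_of_le one_pos (le_max_right _ _),
    lt_of_lt_of_le (by norm_num) (le_max_right _ _), fun m hm => ?_⟩
  have hb₀ : 0 < max b₁ 1 := lt_of_lt_of_le one_pos (le_max_right _ _)
  have hp₀ : 2 < max p₁ 3 := lt_of_lt_of_le (by norm_num) (le_max_right _ _)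
  obtain ⟨γ₁, hγ₁, hγ₁1, hW'⟩ := hW L (max b₁ 1) (max p₁ 3) hb₀ hp₀
  refine ⟨γ₁, hγ₁, fun F γ hFL hγ hγγ₁ => ?_⟩
  obtain ⟨c₀, C₀, A, hc₀, hX⟩ := hW' F γ hFL hγ hγγ₁
  have hγ1 : γ ≤ 1 := hγγ₁.trans hγ₁1
  refine historyTailAt_of_perPlaquette F hγ hγ1 hb₀ (by linarith [le_max_right p₁ 3]) hm
    ⟨Real.exp (9000 * (F.L : ℝ) ^ 3 * |C₀|), 9000 * F.L ^ 3 * A, c₀, (Real.exp_pos _).le, hc₀, ?_⟩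
  exact perPlaquette_of_logStiffness F hγ hγ1 hb₀ hc₀ hX

end Glue


end Summit.QuantumFields.YangMills.Theorems.CoarseStiffnessTailLogStiffness

end
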